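import Summits.CriticalPhenomena.CardyFormulaZ2.Theorems.CardyBoundaryCoulombGasHalfPlaneMarkDensityLawSubsequentialLimits
import Summits.CriticalPhenomena.CardyFormulaZ2.Theorems.HalfPlaneMarkDensityLaw.Negative.OrderHypotheses

/-!
# Line `Sketch`, open stub C⁺ — a priori structure of the collinear half-plane crossing function, VI:
# non-degeneracy from below (crux stmt-CriticalPhenomena-5661, lead c2-0)

`P_n(a,b,c,y) := P_{1/2}[[⌊an⌋,⌊bn⌋]×{0} ↔ [⌊cn⌋,⌊yn⌋]×{0} in ℤ×ℕ]`.  RSW gluing inside the half-plane: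
a top–bottom crossing of the square `[0,s]²` (bottom side in the source arc), a left–right crossing of
`[0,M+s]×[0,s]` and a top–bottom crossing of the square `[M,M+s]×[0,s]` (bottom side in the target arc)
together join the two arcs inside `ℤ×ℕ` (`glue_arcs`, two applications of the rectangle-crossing
Jordan lemma `exists_mem_support_of_crossing`); by Harris–FKG, square crossings `≥ 1/2` and the RSW
lower bound for long rectangles, `P_n(a,b,c,y) ≥ c(a,b,c,y) > 0` eventually (`eventually_pos_le`), so
every joint subsequential limit is POSITIVE on the chamber (`jointLimit_pos`); and one blocked annulus
(`exists_real_boxToFar_le_pow_of_le_half`) bounds it away from `1` for a small source arc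
(`eventually_le_one_sub`, `jointLimit_lt_one_of_small_source`).  (The bound `< 1` in the regime
`η → 1` needs thin blocked half-annuli and is not attempted.)
-/

noncomputable section

namespace Summit.CriticalPhenomena.CardyFormulaZ2.Cruxes.HalfPlaneMarkDensityLaw.SketchLine

open Literature.Probability.Percolation Literature.Probability.LatticeModels
open MeasureTheory Filter Set
open scoped Topology
open Summit.CriticalPhenomena.CardyFormulaZ2.Theorems.HalfPlaneMarkDensityLaw.Negative

namespace Subseq

/-! ## §11 Deterministic gluing of the two arcs -/

/-- **Deterministic gluing.** A top–bottom crossing of `[0,s]²`, a left–right crossing of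
`[0,M+s]×[0,s]` and a top–bottom crossing of `[M,M+s]×[0,s]` join the boundary segments `[0,s]×{0}`
and `[M,M+s]×{0}` inside the lattice half-plane. [folklore] -/
theorem glue_arcs {s M : ℕ} {ω : BondConfig (Site 2)} (hω : ω ⊆ (zdGraph 2).edgeSet)
    (hV₁ : ω ∈ tbCrossing s s) (hH : ω ∈ lrCrossing (M + s) s)
    (hV₂ : ω ∈ openCrossing ((· + (![(M : ℤ), 0] : Site 2)) '' (↑(rectangle s s) : Set (Site 2)))
      ((· + (![(M : ℤ), 0] : Site 2)) '' (↑(bottomSide s s) : Set (Site 2)))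
      ((· + (![(M : ℤ), 0] : Site 2)) '' (↑(topSide s s) : Set (Site 2)))) :
    ω ∈ openCrossing halfPlane (rowIcc 0 s) (rowIcc M (M + s)) := by
  classical
  set Big : Set (Site 2) := ↑(rectangle (M + s) s) with hBig
  have hmemBig : ∀ z : Site 2, z ∈ Big ↔ 0 ≤ z 0 ∧ z 0 ≤ (M : ℤ) + s ∧ 0 ≤ z 1 ∧ z 1 ≤ s := by
    intro z; rw [hBig, Finset.mem_coe, mem_rectangle_iff]; push_cast; exact Iff.rfl
  have hBigH : Big ⊆ halfPlane := fun z hz ↦ by rw [hmemBig] at hz; exact hz.2.2.1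
  have hSqH : (↑(rectangle s s) : Set (Site 2)) ⊆ halfPlane := fun z hz ↦ by
    rw [Finset.mem_coe, mem_rectangle_iff] at hz; exact hz.2.2.1
  have hSq2H : (· + (![(M : ℤ), 0] : Site 2)) '' (↑(rectangle s s) : Set (Site 2)) ⊆ halfPlane := by
    intro z hz; rw [mem_image_add_rectangle] at hz; exact hz.2.2.1
  -- the horizontal crossing
  obtain ⟨x, hx, y, hy, hxy⟩ := hH
  simp only [Finset.mem_coe, leftSide, rightSide, Finset.mem_filter, mem_rectangle_iff] at hx hy
  push_cast at hx hy
  -- its part before the first visit to the column `s`, inside the square `[0,s]²`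
  obtain ⟨z₁, hz₁0, hxz₁⟩ := exists_openConnIn_column hω (s : ℤ) (by rw [hx.2]; positivity)
    (by rw [hy.2]; omega) hxy
  obtain ⟨P₁, hP₁S, hP₁ω⟩ := exists_walk_of_mem_openConnIn hω hxz₁
  have hP₁box : ∀ w ∈ P₁.support, (0 : ℤ) ≤ w 0 ∧ w 0 ≤ s ∧ 0 ≤ w 1 ∧ w 1 ≤ s := by
    intro w hw
    have h := hP₁S w hw
    rw [mem_inter_iff, hmemBig, mem_setOf_eq] at h
    omega
  -- the vertical crossing of the first square
  obtain ⟨b₁, hb₁, t₁, ht₁, hbt₁⟩ := hV₁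
  simp only [Finset.mem_coe, bottomSide, topSide, Finset.mem_filter, mem_rectangle_iff] at hb₁ ht₁
  obtain ⟨Q₁, hQ₁S, hQ₁ω⟩ := exists_walk_of_mem_openConnIn hω hbt₁
  have hQ₁box : ∀ w ∈ Q₁.support, (0 : ℤ) ≤ w 0 ∧ w 0 ≤ s ∧ 0 ≤ w 1 ∧ w 1 ≤ s := by
    intro w hw
    have h := hQ₁S w hw
    rw [Finset.mem_coe, mem_rectangle_iff] at h
    omega
  obtain ⟨w₁, hw₁P, hw₁Q⟩ := exists_mem_support_of_crossing (L := 0) (R := s) (B := 0) (T := s)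
    P₁ Q₁ hP₁box hQ₁box hx.2 hz₁0 hb₁.2 ht₁.2
  -- the part of the horizontal crossing after its last visit to the column `M`
  have hyx : ω ∈ openConnIn Big y x := by rw [openConnIn_comm]; exact hxy
  obtain ⟨z₂, hz₂0, hyz₂⟩ := exists_openConnIn_column_ge hω (M : ℤ) (by rw [hy.2]; omega)
    (by rw [hx.2]; positivity) hyx
  have hz₂y : ω ∈ openConnIn (Big ∩ {z | (M : ℤ) ≤ z 0}) z₂ y := by rw [openConnIn_comm]; exact hyz₂
  obtain ⟨P₂, hP₂S, hP₂ω⟩ := exists_walk_of_mem_openConnIn hω hz₂y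
  have hP₂box : ∀ w ∈ P₂.support, (M : ℤ) ≤ w 0 ∧ w 0 ≤ M + s ∧ 0 ≤ w 1 ∧ w 1 ≤ s := by
    intro w hw
    have h := hP₂S w hw
    rw [mem_inter_iff, hmemBig, mem_setOf_eq] at h
    omega
  -- the vertical crossing of the second square
  obtain ⟨b₂, hb₂, t₂, ht₂, hbt₂⟩ := hV₂
  rw [mem_image_add_bottomSide] at hb₂
  rw [mem_image_add_topSide] at ht₂
  simp only [Matrix.cons_val_zero, Matrix.cons_val_one, zero_add] at hb₂ ht₂
  obtain ⟨Q₂, hQ₂S, hQ₂ω⟩ := exists_walk_of_mem_openConnIn hω hbt₂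
  have hQ₂box : ∀ w ∈ Q₂.support, (M : ℤ) ≤ w 0 ∧ w 0 ≤ M + s ∧ 0 ≤ w 1 ∧ w 1 ≤ s := by
    intro w hw
    have h := hQ₂S w hw
    rw [mem_image_add_rectangle] at h
    simp only [Matrix.cons_val_zero, Matrix.cons_val_one, zero_add] at h
    omega
  obtain ⟨w₂, hw₂P, hw₂Q⟩ := exists_mem_support_of_crossing (L := (M : ℤ)) (R := M + s) (B := 0)
    (T := s) P₂ Q₂ hP₂box hQ₂box hz₂0 (by rw [hy.2]) hb₂.2 ht₂.2
  -- assemble `b₁ ↔ w₁ ↔ x ↔ y ↔ z₂ ↔ w₂ ↔ b₂` inside the half-plane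
  have c₁ : ω ∈ openConnIn halfPlane b₁ w₁ :=
    openConnIn_mono hSqH _ _ (mem_openConnIn_of_mem_support Q₁ hQ₁S hQ₁ω hw₁Q)
  have c₂ : ω ∈ openConnIn halfPlane w₁ x := by
    rw [openConnIn_comm]
    exact openConnIn_mono (inter_subset_left.trans hBigH) _ _
      (mem_openConnIn_of_mem_support P₁ hP₁S hP₁ω hw₁P)
  have c₃ : ω ∈ openConnIn halfPlane x y := openConnIn_mono hBigH _ _ hxy
  have c₄ : ω ∈ openConnIn halfPlane y z₂ :=
    openConnIn_mono (inter_subset_left.trans hBigH) _ _ hyz₂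
  have c₅ : ω ∈ openConnIn halfPlane z₂ w₂ :=
    openConnIn_mono (inter_subset_left.trans hBigH) _ _
      (mem_openConnIn_of_mem_support P₂ hP₂S hP₂ω hw₂P)
  have c₆ : ω ∈ openConnIn halfPlane w₂ b₂ := by
    rw [openConnIn_comm]
    exact openConnIn_mono hSq2H _ _ (mem_openConnIn_of_mem_support Q₂ hQ₂S hQ₂ω hw₂Q)
  refine ⟨b₁, ⟨hb₁.2, hb₁.1.1, hb₁.1.2.1⟩, b₂, ⟨hb₂.2, hb₂.1.1, hb₂.1.2.1⟩, ?_⟩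
  exact PlanarDuality.openConnIn_trans (PlanarDuality.openConnIn_trans
    (PlanarDuality.openConnIn_trans (PlanarDuality.openConnIn_trans
      (PlanarDuality.openConnIn_trans c₁ c₂) c₃) c₄) c₅) c₆

/-! ## §12 The RSW lower bound -/

/-- **Lattice lower bound**: `P[[0,s]×{0} ↔ [M,M+s]×{0} in ℤ×ℕ] ≥ c_H/4` whenever the left–right
crossing of `[0,M+s]×[0,s]` has probability `≥ c_H` (Harris–FKG twice, square crossings `≥ 1/2`,
translation invariance, `glue_arcs`). [folklore] -/
theorem le_crossing_glue (s M : ℕ) {cH : ℝ} (hcH0 : 0 ≤ cH) (hcH : cH ≤ μ.real (lrCrossing (M + s) s)) :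
    cH / 4 ≤ μ.real (openCrossing halfPlane (rowIcc 0 s) (rowIcc M (M + s))) := by
  set V₁ := tbCrossing s s with hV₁def
  set Hc := lrCrossing (M + s) s with hHcdef
  set V₂ := openCrossing ((· + (![(M : ℤ), 0] : Site 2)) '' (↑(rectangle s s) : Set (Site 2)))
      ((· + (![(M : ℤ), 0] : Site 2)) '' (↑(bottomSide s s) : Set (Site 2)))
      ((· + (![(M : ℤ), 0] : Site 2)) '' (↑(topSide s s) : Set (Site 2))) with hV₂def
  have hsq : 1 / 2 ≤ μ.real (tbCrossing s s) := by
    have h := real_tbCrossing half s s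
    rw [show bondPercolation (zdGraph 2) half = μ from rfl] at h
    rw [h]; exact half_le_crossingProb_self crossingProb_half_succ_self_holds s
  have hV₁ : 1 / 2 ≤ μ.real V₁ := hsq
  have hV₂ : 1 / 2 ≤ μ.real V₂ := by
    rw [hV₂def]
    unfold μ
    rw [real_openCrossing_shift]
    exact hsq
  have hupV₁ : IsUpperSet V₁ := isUpperSet_openCrossing _ _ _
  have hupH : IsUpperSet Hc := isUpperSet_openCrossing _ _ _
  have hupV₂ : IsUpperSet V₂ := isUpperSet_openCrossing _ _ _
  have hmV₁ : MeasurableSet V₁ := measurableSet_openCrossing_of_countable _ _ _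
  have hmH : MeasurableSet Hc := measurableSet_openCrossing_of_countable _ _ _
  have hmV₂ : MeasurableSet V₂ := measurableSet_openCrossing_of_countable _ _ _
  have hfkg1 : μ.real V₁ * μ.real Hc ≤ μ.real (V₁ ∩ Hc) :=
    harris_fkg_holds (zdGraph 2) half hupV₁ hupH hmV₁ hmH
  have hfkg2 : μ.real (V₁ ∩ Hc) * μ.real V₂ ≤ μ.real (V₁ ∩ Hc ∩ V₂) :=
    harris_fkg_holds (zdGraph 2) half (hupV₁.inter hupH) hupV₂ (hmV₁.inter hmH) hmV₂
  have hincl : μ.real (V₁ ∩ Hc ∩ V₂) ≤ μ.real (openCrossing halfPlane (rowIcc 0 s) (rowIcc M (M + s))) := by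
    rw [measureReal_def, measureReal_def]
    refine ENNReal.toReal_mono (measure_ne_top _ _) (measure_mono_ae ?_)
    filter_upwards [ae_subset_edgeSet (zdGraph 2) half] with ω hω
    rintro ⟨⟨h1, h2⟩, h3⟩
    exact glue_arcs hω h1 h2 h3
  have hV₁0 : 0 ≤ μ.real V₁ := measureReal_nonneg
  have hV₂0 : 0 ≤ μ.real V₂ := measureReal_nonneg
  calc cH / 4 = 1 / 2 * cH * (1 / 2) := by ring
    _ ≤ μ.real V₁ * μ.real Hc * μ.real V₂ := by gcongr
    _ ≤ μ.real (V₁ ∩ Hc) * μ.real V₂ := by gcongr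
    _ ≤ μ.real (V₁ ∩ Hc ∩ V₂) := hfkg2
    _ ≤ _ := hincl

/-- The RSW input: for aspect `K ≥ 2`, `P[LR crossing of [0,M+s]×[0,s]] ≥ c_K` whenever
`M + s ≤ K(s+1) − 1` (`rsw_lowerBound_holds` + monotonicity in the length). [folklore] -/
theorem exists_rsw_const (K : ℕ) (hK : 2 ≤ K) :
    ∃ cK : ℝ, 0 < cK ∧ ∀ s M : ℕ, M + s ≤ K * (s + 1) - 1 → cK ≤ μ.real (lrCrossing (M + s) s) := by
  obtain ⟨cK, hcK, hcross⟩ := rsw_lowerBound_holds K hK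
  refine ⟨cK, hcK, fun s M hMs ↦ ?_⟩
  have h1 := hcross (s + 1) (by omega)
  rw [show s + 1 - 1 = s by omega] at h1
  have h2 : crossingProb half (K * (s + 1) - 1) s ≤ crossingProb half (M + s) s :=
    crossingProb_anti_left half hMs s
  exact h1.trans h2

/-- **Eventual positive lower bound for `P_n`** on the chamber: there is `c₀ = c₀(a,b,c,y) > 0` with
`P_n(a,b,c,y) ≥ c₀` eventually in `n`. [folklore] -/
theorem eventually_pos_le {a b c y : ℝ} (hab : a < b) (hbc : b < c) (hcy : c < y) :
    ∃ c₀ : ℝ, 0 < c₀ ∧ ∀ᶠ n : ℕ in atTop,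
      c₀ ≤ μ.real (openCrossing halfPlane (arcA a b n) (rowIcc ⌊c * n⌋ ⌊y * n⌋)) := by
  set d := min (b - a) (y - c) with hd
  have hd0 : 0 < d := lt_min (by linarith) (by linarith)
  have hdba : d ≤ b - a := min_le_left _ _
  have hdyc : d ≤ y - c := min_le_right _ _
  set K : ℕ := ⌈(y - a) / d⌉₊ + 2 with hK
  have hK2 : 2 ≤ K := by omega
  obtain ⟨cK, hcK, hRSW⟩ := exists_rsw_const K hK2
  refine ⟨cK / 4, by positivity, ?_⟩
  have hKge : (y - a) / d + 2 ≤ K := by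
    rw [hK]; push_cast; linarith [Nat.le_ceil ((y - a) / d)]
  have e1 : ∀ᶠ n : ℕ in atTop, (y - a) / d + 6 ≤ d * n :=
    (tendsto_natCast_atTop_atTop.const_mul_atTop hd0).eventually_ge_atTop _
  filter_upwards [e1] with n hn
  -- the lattice data
  have hyad : 0 ≤ (y - a) / d := div_nonneg (by linarith) hd0.le
  set s : ℕ := ⌊d * n⌋₊ - 2 with hs
  have hdn2 : (2 : ℝ) ≤ ⌊d * (n : ℝ)⌋₊ := by
    have := Nat.floor_le_floor (show (3 : ℝ) ≤ d * n by linarith)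
    rw [show ⌊(3 : ℝ)⌋₊ = 3 by norm_num] at this
    exact_mod_cast (by omega : 2 ≤ ⌊d * (n : ℝ)⌋₊)
  have hscast : (s : ℝ) = ⌊d * (n : ℝ)⌋₊ - 2 := by
    rw [hs, Nat.cast_sub (by exact_mod_cast hdn2)]; norm_num
  have hs_le : (s : ℝ) ≤ d * n - 2 := by rw [hscast]; linarith [Nat.floor_le (by positivity : 0 ≤ d * n)]
  have hs_ge : d * n - 3 < s := by rw [hscast]; linarith [Nat.sub_one_lt_floor (d * n)]
  have ha1 : (⌊a * n⌋ : ℝ) ≤ a * n := Int.floor_le _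
  have ha2 : (a * n : ℝ) < ⌊a * n⌋ + 1 := Int.lt_floor_add_one _
  have hb2 : (b * n : ℝ) < ⌊b * n⌋ + 1 := Int.lt_floor_add_one _
  have hc1 : (⌊c * n⌋ : ℝ) ≤ c * n := Int.floor_le _
  have hc2 : (c * n : ℝ) < ⌊c * n⌋ + 1 := Int.lt_floor_add_one _
  have hy2 : (y * n : ℝ) < ⌊y * n⌋ + 1 := Int.lt_floor_add_one _
  have hMpos : 0 ≤ ⌊c * (n : ℝ)⌋ - ⌊a * (n : ℝ)⌋ := by
    have : ((⌊a * (n : ℝ)⌋ : ℤ) : ℝ) < ⌊c * (n : ℝ)⌋ + 1 := by nlinarith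
    have := Int.cast_lt.1 (by push_cast; linarith : ((⌊a * (n : ℝ)⌋ : ℤ) : ℝ) < ((⌊c * (n:ℝ)⌋ + 1 : ℤ) : ℝ))
    omega
  set M : ℕ := (⌊c * (n : ℝ)⌋ - ⌊a * (n : ℝ)⌋).toNat with hM
  have hMcast : (M : ℤ) = ⌊c * (n : ℝ)⌋ - ⌊a * (n : ℝ)⌋ := Int.toNat_of_nonneg hMpos
  have hMreal : (M : ℝ) = ⌊c * (n : ℝ)⌋ - ⌊a * (n : ℝ)⌋ := by exact_mod_cast hMcast
  -- arcs: [⌊an⌋, ⌊an⌋+s] ⊆ A_n and [⌊cn⌋, ⌊cn⌋+s] ⊆ C_n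
  have hsA : ⌊a * (n : ℝ)⌋ + s ≤ ⌊b * (n : ℝ)⌋ := by
    have : ((⌊a * (n : ℝ)⌋ + s : ℤ) : ℝ) < ((⌊b * (n : ℝ)⌋ + 1 : ℤ) : ℝ) := by
      push_cast; nlinarith
    have := Int.cast_lt.1 this; omega
  have hsC : ⌊c * (n : ℝ)⌋ + s ≤ ⌊y * (n : ℝ)⌋ := by
    have : ((⌊c * (n : ℝ)⌋ + s : ℤ) : ℝ) < ((⌊y * (n : ℝ)⌋ + 1 : ℤ) : ℝ) := by
      push_cast; nlinarith
    have := Int.cast_lt.1 this; omega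
  -- aspect ratio
  have hMs : M + s ≤ K * (s + 1) - 1 := by
    have hreal : (M : ℝ) + s + 1 ≤ (K : ℝ) * (s + 1) := by
      have h1 : (M : ℝ) ≤ (c - a) * n + 1 := by rw [hMreal]; linarith
      have h2 : ((y - a) / d + 2) * ((s : ℝ) + 1) ≤ (K : ℝ) * (s + 1) :=
        mul_le_mul_of_nonneg_right hKge (by positivity)
      have h3 : (y - a) / d * ((s : ℝ) + 1) ≥ (y - a) / d * (d * n - 2) :=
        mul_le_mul_of_nonneg_left (by linarith) hyad
      have h4 : (y - a) / d * (d * (n : ℝ)) = (y - a) * n := by field_simp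
      nlinarith
    have : ((M + s + 1 : ℕ) : ℝ) ≤ ((K * (s + 1) : ℕ) : ℝ) := by push_cast; linarith
    have := (Nat.cast_le (α := ℝ)).1 this
    omega
  have hkey := le_crossing_glue s M hcK.le (hRSW s M hMs)
  -- monotonicity (shrink both arcs) and translation by ⌊an⌋
  have hshift := crossing_shift ⌊a * (n : ℝ)⌋ 0 s M (M + s)
  rw [zero_add] at hshift
  have hmono : μ.real (openCrossing halfPlane (rowIcc ⌊a * (n : ℝ)⌋ (s + ⌊a * (n : ℝ)⌋))
      (rowIcc (M + ⌊a * (n : ℝ)⌋) (M + s + ⌊a * (n : ℝ)⌋))) ≤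
      μ.real (openCrossing halfPlane (arcA a b n) (rowIcc ⌊c * n⌋ ⌊y * n⌋)) := by
    rw [arcA_eq_rowIcc]
    refine measureReal_mono (openCrossing_mono subset_rfl ?_ ?_) (measure_ne_top _ _)
    · intro v ⟨h1, h2, h3⟩; exact ⟨h1, h2, by omega⟩
    · intro v ⟨h1, h2, h3⟩; exact ⟨h1, by omega, by omega⟩
  linarith [hkey, hshift.symm.le]

/-- **Upper bound away from `1` for a small source arc** (blocked annulus of aspect `3`,
`exists_real_boxToFar_le_pow_of_le_half` with one annulus): if `12(b − a) < c − a`, then eventually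
`P_n(a,b,c,y) ≤ 1 − c_blk`. (By `…Symmetry`, the same holds for a small target arc.) [folklore] -/
theorem eventually_le_one_sub {a b c y : ℝ} (hab : a ≤ b) (h12 : 12 * (b - a) < c - a) :
    ∃ c₁ : ℝ, 0 < c₁ ∧ ∀ᶠ n : ℕ in atTop,
      μ.real (openCrossing halfPlane (arcA a b n) (rowIcc ⌊c * n⌋ ⌊y * n⌋)) ≤ 1 - c₁ := by
  obtain ⟨c₁, hc₁, hblk⟩ := exists_real_boxToFar_le_pow_of_le_half
  refine ⟨c₁, hc₁, ?_⟩
  have hgap : 0 < c - a - 12 * (b - a) := by linarith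
  filter_upwards [(tendsto_natCast_atTop_atTop.const_mul_atTop hgap).eventually_ge_atTop 26] with n hn
  set r : ℕ := ⌈(b - a) * n⌉₊ + 1 with hr
  have hba : 0 ≤ (b - a) * n := mul_nonneg (by linarith) (Nat.cast_nonneg n)
  have hr_lt : (r : ℝ) < (b - a) * n + 2 := by
    rw [hr]; push_cast; have := Nat.ceil_lt_add_one hba; linarith
  have h1 : (⌊a * n⌋ : ℝ) ≤ a * n := Int.floor_le _
  have h2 : (c * n : ℝ) < ⌊c * n⌋ + 1 := Int.lt_floor_add_one _
  have hfar : ∀ v ∈ rowIcc ⌊c * (n : ℝ)⌋ ⌊y * (n : ℝ)⌋,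
      v 0 + ((12 * r : ℕ) : ℤ) < ⌊a * (n : ℝ)⌋ ∨ ⌊a * (n : ℝ)⌋ + ((12 * r : ℕ) : ℤ) < v 0 := by
    intro v hv
    right
    have h3 : ((⌊a * (n : ℝ)⌋ + ((12 * r : ℕ) : ℤ) : ℤ) : ℝ) < ((⌊c * (n : ℝ)⌋ : ℤ) : ℝ) := by
      push_cast; nlinarith
    have := Int.cast_lt.1 h3
    have := hv.2.1
    omega
  calc μ.real (openCrossing halfPlane (arcA a b n) (rowIcc ⌊c * n⌋ ⌊y * n⌋))
      ≤ μ.real (openCrossing univ ((· + (![⌊a * (n : ℝ)⌋, 0] : Site 2)) '' (box 2 r : Set (Site 2)))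
          ((· + (![⌊a * (n : ℝ)⌋, 0] : Site 2)) '' ((box 2 (12 * r) : Set (Site 2))ᶜ))) :=
        measureReal_mono (interval_crossing_subset_escape halfPlane
          (k₁ := ⌊a * (n : ℝ)⌋) (k₂ := ⌊b * (n : ℝ)⌋) (floor_sub_floor_le le_rfl n) hfar)
          (measure_ne_top _ _)
    _ = μ.real {ω : BondConfig (Site 2) | ∃ x ∈ box 2 r, ∃ y ∉ box 2 (12 * r), ω ∈ openConnIn univ x y} :=
        measureReal_escape_shift _ _ _
    _ ≤ (1 - c₁) ^ 1 := hblk half (by simp) r (12 * r) 1 (by omega) (by omega)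
    _ = 1 - c₁ := pow_one _

/-! ## §13 Joint subsequential limits are positive -/

/-- **Positivity**: every joint subsequential limit is positive on the chamber. [folklore] -/
theorem jointLimit_pos {θ : ℕ → ℕ} {G : ℝ → ℝ → ℝ → ℝ → ℝ}
    (hG : ∀ a b c y : ℝ, a < b → b < c → c < y →
      Tendsto (fun n ↦ μ.real (openCrossing halfPlane (arcA a b (θ n))
        (rowIcc ⌊c * (θ n : ℕ)⌋ ⌊y * (θ n : ℕ)⌋))) atTop (𝓝 (G a b c y)))
    (hθ : StrictMono θ) {a b c y : ℝ} (hab : a < b) (hbc : b < c) (hcy : c < y) :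
    0 < G a b c y := by
  obtain ⟨c₀, hc₀, hev⟩ := eventually_pos_le hab hbc hcy
  exact lt_of_lt_of_le hc₀ (ge_of_tendsto (hG a b c y hab hbc hcy) (hθ.tendsto_atTop.eventually hev))

/-- **Below `1` for a small source arc**: if `12(b − a) < c − a`, a joint subsequential limit is
`< 1` (one blocked annulus). [folklore] -/
theorem jointLimit_lt_one_of_small_source {θ : ℕ → ℕ} {G : ℝ → ℝ → ℝ → ℝ → ℝ}
    (hG : ∀ a b c y : ℝ, a < b → b < c → c < y →
      Tendsto (fun n ↦ μ.real (openCrossing halfPlane (arcA a b (θ n))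
        (rowIcc ⌊c * (θ n : ℕ)⌋ ⌊y * (θ n : ℕ)⌋))) atTop (𝓝 (G a b c y)))
    (hθ : StrictMono θ) {a b c y : ℝ} (hab : a < b) (hbc : b < c) (hcy : c < y)
    (h12 : 12 * (b - a) < c - a) : G a b c y < 1 := by
  obtain ⟨c₁, hc₁, hev⟩ := eventually_le_one_sub hab.le h12
  exact lt_of_le_of_lt (le_of_tendsto (hG a b c y hab hbc hcy) (hθ.tendsto_atTop.eventually hev))
    (by linarith)

end Subseq

/-- **Registered extra stub of line `Sketch` (lead c2-0): non-degeneracy from below.**  For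
`a < b < c < y` there is `c₀ > 0` with `P_n(a,b,c,y) ≥ c₀` eventually in `n` (RSW gluing in `ℤ×ℕ`).
[folklore] -/
theorem stub_nonDegeneracy :
    ∀ (a b c y : ℝ), a < b → b < c → c < y → ∃ c₀ : ℝ, 0 < c₀ ∧ ∀ᶠ n : ℕ in atTop,
      c₀ ≤ μ.real (openCrossing halfPlane (arcA a b n) (rowIcc ⌊c * n⌋ ⌊y * n⌋)) :=
  fun _ _ _ _ hab hbc hcy ↦ Subseq.eventually_pos_le hab hbc hcy

end Summit.CriticalPhenomena.CardyFormulaZ2.Cruxes.HalfPlaneMarkDensityLaw.SketchLine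

end
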